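import Mathlib
import HarnessLib
import Summits.HubbardSuperconductivity.HubbardSuperconductivity.Theorems.KLProgrammeKLRegimeVolumeLimitDyson
import Summits.HubbardSuperconductivity.HubbardSuperconductivity.Theorems.KLProgrammeKLRegimeVolumeLimitSecondOrderWick

/-!
# The bare-frame VL carrier at finite cutoff is EXACTLY «U · Hartree density + U² · current–current»:
# `Σ̂⁰_{L,M}(k,σ) = (βL²/Z)·( U(βL²)⁻³·∫e^{−V}Σ_q ψ̂⁺_{qσ̄}ψ̂⁻_{qσ̄} + U²·∫e^{−V}(∂⁺_{kσ}W)(∂⁻_{kσ}W) )` (seat hubbard-kl-k3c5-p2, g2)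

Route `KLProgramme`, gen-4 child 5 `KLRegimeVolumeLimitV12` (stmt-HubbardSuperconductivity-19858; registered stub `stub_vl_bound` = a volume-uniform
bound on `klSelfEnergy … (nScales β + 1)` beyond the prover's own Matsubara threshold).  Combining the exact finite-cutoff Schwinger–Dyson form
(`…VolumeLimitDyson.klSelfEnergy_nScales_succ_eq_dyson`, this seat) with k3c5-p3's second-derivative identities
(`…VolumeLimitSecondOrderWick.dd_up_hubbardInteraction` / `dd_down_hubbardInteraction`: `∂⁺_{kσ}∂⁻_{kσ}W = −(βL²)⁻³Σ_q ψ̂⁺_{qσ̄}ψ̂⁻_{qσ̄}`) gives, in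
the BARE frame `K = 0` (`V = U•W`, `W = hubbardInteraction L M β 1`), for every real `U` and every volume with `Z = D_{L,M}(U) ≠ 0`:

  `klSelfEnergy L M β U μ 0 klE0 (nScales β + 1) k σ
     = (βL²/Z)·( U·(βL²)⁻³·∫dμ_C e^{−V} Σ_q ψ̂⁺_{qσ̄}ψ̂⁻_{qσ̄} + U²·∫dμ_C e^{−V}·(∂⁺_{kσ}W)(∂⁻_{kσ}W) )`

(`klSelfEnergy_bare_eq_hartree_add_current_up/_down`): the first term is `U` times the normalised opposite-spin DENSITY insertion (frequency- and
momentum-INDEPENDENT), the second `U²` times the normalised correlation of the two cubic currents `∂^±_{kσ}W` — the finite-`M` twin of the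
Hamiltonian identity `(ĝ − 𝒢)(−ik₀+ξ)² = U⟨{T,c†}⟩ − U²𝒵` (`…ThermalGreenHubbardTorusExact`).  Steps 2–3 of HOME/hubbard-kl-k3c5-p2/TAU-BRIDGE.md §6 bound
exactly these two normalised expectations.  Any other frame follows by `finalTwoLegVolLimit_frame_transfer'` (`…VolumeLimitOneFrame`) or by the
frame-`K` form of `klSelfEnergy_nScales_succ_eq_dyson`.  Everything is proved; no definition.
-/

noncomputable section

namespace Summit.HubbardSuperconductivity.HubbardSuperconductivity.Theorems.TwoPointAssembly

set_option linter.dupNamespace false -- summit = problem name (single-conjunct summit), D-0017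

open Finset Literature.MathematicalPhysics.QuantumLattice Literature.Probability.LatticeModels GrassmannAlgebra
open Summit.HubbardSuperconductivity.HubbardSuperconductivity.Theorems.KLRegimeSplit
open Summit.HubbardSuperconductivity.HubbardSuperconductivity.Theorems.KLProgrammeLegKernels

variable {L M : ℕ} [NeZero L]

omit [NeZero L] in
/-- The composite of the Dyson form for `V = U•W`, given the second-derivative identity `∂⁺∂⁻W = −r•N`:
`∂⁺∂⁻V − ∂⁺V·∂⁻V = −(U r)•N − U²•(∂⁺W·∂⁻W)`. -/
theorem dyson_composite_of_smul (a b : HubbardFieldIdx L M) (U : ℂ) (W N : HubbardGrassmann L M) (r : ℂ)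
    (hdd : grassmannDeriv ℂ a (grassmannDeriv ℂ b W) = -(r • N)) :
    grassmannDeriv ℂ a (grassmannDeriv ℂ b (U • W)) - grassmannDeriv ℂ a (U • W) * grassmannDeriv ℂ b (U • W) =
      -((U * r) • N) - (U ^ 2) • (grassmannDeriv ℂ a W * grassmannDeriv ℂ b W) := by
  simp only [map_smul, hdd, smul_neg]
  rw [smul_mul_smul_comm, smul_smul, sq]

/-- **BARE-FRAME CARRIER = U·HARTREE + U²·CURRENT–CURRENT, spin `↑`** (finite cutoff, every real `U`, bare `Z ≠ 0`). -/
theorem klSelfEnergy_bare_eq_hartree_add_current_up {β : ℝ} (hβ : 0 < β) (U μ : ℝ) (k : FreqMomentum L M)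
    (hD : effPartitionFn ℂ (hubbardCovariance L M β μ 0) (hubbardInteraction L M β U) ≠ 0) :
    klSelfEnergy L M β U μ 0 klE0 (nScales β + 1) k 0 =
      (((β * (L : ℝ) ^ 2 : ℝ) : ℂ) / effPartitionFn ℂ (hubbardCovarianceCT L M β μ 0 0) (hubbardInteraction L M β U)) *
        ((U : ℂ) * (((1 / (β * (L : ℝ) ^ 2) ^ 3 : ℝ) : ℂ)) *
            gaussExpect ℂ (hubbardCovarianceCT L M β μ 0 0)
              (grassmannExp (-(hubbardInteraction L M β U)) * ∑ q : FreqMomentum L M, psiPlus q 1 * psiMinus q 1) +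
          (U : ℂ) ^ 2 *
            gaussExpect ℂ (hubbardCovarianceCT L M β μ 0 0)
              (grassmannExp (-(hubbardInteraction L M β U)) *
                (grassmannDeriv ℂ (((k, 0), 0) : HubbardFieldIdx L M) (hubbardInteraction L M β 1) *
                  grassmannDeriv ℂ (((k, 0), 1) : HubbardFieldIdx L M) (hubbardInteraction L M β 1)))) := by
  have h := klSelfEnergy_nScales_succ_eq_dyson hβ U μ 0 k 0 hD
  rw [hubbardInteractionCT_zero_frame] at h
  rw [h]
  set E : HubbardGrassmann L M := grassmannExp (-(hubbardInteraction L M β U)) with hE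
  have hV : hubbardInteraction L M β U = (U : ℂ) • hubbardInteraction L M β 1 := hubbardInteraction_eq_smul_one β U
  have hcomp := dyson_composite_of_smul (((k, 0), 0) : HubbardFieldIdx L M) (((k, 0), 1) : HubbardFieldIdx L M) (U : ℂ)
    (hubbardInteraction L M β 1) (∑ q : FreqMomentum L M, psiPlus q 1 * psiMinus q 1) (((1 / (β * (L : ℝ) ^ 2) ^ 3 : ℝ) : ℂ))
    (dd_up_hubbardInteraction β k)
  rw [← hV] at hcomp
  rw [hcomp, mul_sub, mul_neg, Algebra.mul_smul_comm, Algebra.mul_smul_comm, map_sub, map_neg, map_smul, map_smul, smul_eq_mul, smul_eq_mul]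
  ring

/-- **BARE-FRAME CARRIER = U·HARTREE + U²·CURRENT–CURRENT, spin `↓`** (finite cutoff, every real `U`, bare `Z ≠ 0`). -/
theorem klSelfEnergy_bare_eq_hartree_add_current_down {β : ℝ} (hβ : 0 < β) (U μ : ℝ) (k : FreqMomentum L M)
    (hD : effPartitionFn ℂ (hubbardCovariance L M β μ 0) (hubbardInteraction L M β U) ≠ 0) :
    klSelfEnergy L M β U μ 0 klE0 (nScales β + 1) k 1 =
      (((β * (L : ℝ) ^ 2 : ℝ) : ℂ) / effPartitionFn ℂ (hubbardCovarianceCT L M β μ 0 0) (hubbardInteraction L M β U)) *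
        ((U : ℂ) * (((1 / (β * (L : ℝ) ^ 2) ^ 3 : ℝ) : ℂ)) *
            gaussExpect ℂ (hubbardCovarianceCT L M β μ 0 0)
              (grassmannExp (-(hubbardInteraction L M β U)) * ∑ q : FreqMomentum L M, psiPlus q 0 * psiMinus q 0) +
          (U : ℂ) ^ 2 *
            gaussExpect ℂ (hubbardCovarianceCT L M β μ 0 0)
              (grassmannExp (-(hubbardInteraction L M β U)) *
                (grassmannDeriv ℂ (((k, 1), 0) : HubbardFieldIdx L M) (hubbardInteraction L M β 1) *
                  grassmannDeriv ℂ (((k, 1), 1) : HubbardFieldIdx L M) (hubbardInteraction L M β 1)))) := by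
  have h := klSelfEnergy_nScales_succ_eq_dyson hβ U μ 0 k 1 hD
  rw [hubbardInteractionCT_zero_frame] at h
  rw [h]
  have hV : hubbardInteraction L M β U = (U : ℂ) • hubbardInteraction L M β 1 := hubbardInteraction_eq_smul_one β U
  have hcomp := dyson_composite_of_smul (((k, 1), 0) : HubbardFieldIdx L M) (((k, 1), 1) : HubbardFieldIdx L M) (U : ℂ)
    (hubbardInteraction L M β 1) (∑ q : FreqMomentum L M, psiPlus q 0 * psiMinus q 0) (((1 / (β * (L : ℝ) ^ 2) ^ 3 : ℝ) : ℂ))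
    (dd_down_hubbardInteraction β k)
  rw [← hV] at hcomp
  rw [hcomp, mul_sub, mul_neg, Algebra.mul_smul_comm, Algebra.mul_smul_comm, map_sub, map_neg, map_smul, map_smul, smul_eq_mul, smul_eq_mul]
  ring

end Summit.HubbardSuperconductivity.HubbardSuperconductivity.Theorems.TwoPointAssembly

end
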